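import Summits.CriticalPhenomena.PercolationContinuityZ3.Theorems.PercNearOneGluingNoHeavyLowerTailQuantitativeKNMargin
import HarnessLib

/-!
# `NoHeavyLowerTail` (stmt-CriticalPhenomena-4575) — THE QUANTITATIVE KOZMA–NITZAN INEQUALITY (Q-KN) for EVERY relay set:
# the pre-FKG deficit dominates the attachment-weighted detachment gaps

Support file (`--supports stmt-CriticalPhenomena-4575`), prover `prim-ineq-gen-6` (gen 9; memo `prim-ineq-gen-6/FINDING-G9.md` §1).
No definitions, no named facts, no sorries; standard axioms.  Third of three files: `…QuantitativeLemmaAC` → `…QuantitativeKNMargin` → this file.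

THEOREM (Q-KN; conjectured in `prim-ineq-gen-6/FINDING-G4.md` §8 for `F = 1{b ∈ ·}` with 0 violations in 2·10⁷ exact tests — here for every
monotone cluster property).  Finite graph, non-degenerate weights, `F` monotone on vertex sets, relay set `A`, observer `o ∉ A`, and `c ∈ A` ANY
relay of least mean `m_c = E F(C(c)) ≤ m_a` (ties allowed).  With `φ_a := μ(o ↔ a | a ↮ A∖a)` (`= CSH.avoidConst w a (A∖a) o`):

  `E[(F(C(o)) − F(C(c))); o ↔ A]  ≥  Σ_{a ∈ A∖c} (m_a − m_c) · φ_a`      (`PreFKGSurplus.quantitative_kn_conj4_holds`),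

in particular  `P(o ↔ b, o ↔ A) − P(c ↔ b, o ↔ A) ≥ Σ_{a ≠ c} φ_a · (P(a ↔ b) − P(c ↔ b))`  (`PreFKGSurplus.quantitativeKN_holds`), and, with
`F = 1{|· ∩ A| > t}`, the φ-mixture cumulative isolation inequality Q-CIL_t of FINDING-G4 §10 for every level `t` (`PreFKGSurplus.quantitativeCIL_holds`).
The right-hand side is `≥ 0`, so this sharpens Kozma–Nitzan's Conjecture 4 / Conjecture 2 for every `|A|` (gen 8's `PreFKGSurplus.kn_conj4_holds`,
prim-cplus-coupling's all-weights closure) by an explicit BHK-type lower bound; it is an identity when `o` is pendant to a single relay, and for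
`|A| = 2` it is the two-BHK-step inequality `QuantitativePreFKG.quantitativePreFKG_pair` (gen 4).  Printed special case: the last display of
Kozma–Nitzan's proof of Theorem 3 (`|A| = 3`, `A` separating `o` from `b`).
PROOF: peel one relay `k ≠ c` with vdBHK Thm 1.3 exactly as in `kn_conj4_of_csh`, and use the quantitative two-observer margin
`PreFKGSurplus.preMargin_ge_sum_of_csh` at `D = []`, observers `(o, k)`; the coefficient of the peeled relay is `μ(o ↔ k | k ↮ A∖k) = φ_k` exactly.
[cite: KozmaNitzan2024, Conj. 4 (p. 32), Conj. 2 (p. 3), Thm. 3 (p. 10), Lemma 2 (p. 6), Question 7 (p. 36)]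
[cite: VandenbergHaggstromKahn2005, Thm. 1.3 (p. 6), §2.1 Lemma 2.4 (p. 10)]
-/

noncomputable section

namespace Summit.CriticalPhenomena.PercolationContinuityZ3.Theorems

open MeasureTheory Set Literature.Probability.LatticeModels Literature.Probability.Percolation
open scoped Classical
open KNPreFKG CSH

namespace PreFKGSurplus

variable {n : ℕ}

/-- **THE QUANTITATIVE KOZMA–NITZAN INEQUALITY (Q-KN) for every relay set, from the conditioned slack hierarchy.**  Non-degenerate weights,
`hCSH` = prim-hp-8's Theorem 1 (as in `kn_conj4_of_csh`).  For every relay set `A`, every observer `o ∉ A`, every monotone `F` and ANY `c ∈ A`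
of least mean `m_c = E F(C(c))`:
`Σ_{a ∈ A∖c} (m_a − m_c) · μ(o ↔ a | a ↮ A∖a) ≤ E[F(C(o)); o ↔ A] − E[F(C(c)); o ↔ A]`
(`μ(o ↔ a | a ↮ A∖a) = CSH.avoidConst w a (A∖a) o`).  Proof: peel one relay `k ≠ c` with vdBHK Thm 1.3 (as in `kn_conj4_of_csh`) and use the
quantitative two-observer margin `preMargin_ge_sum_of_csh` at `D = []`, observers `(o, k)`.
[cite: KozmaNitzan2024, Conj. 4 (p. 32), Lemma 2 (p. 6), Question 7 (p. 36)] [cite: VandenbergHaggstromKahn2005, Thm. 1.3 (p. 6), §2.1 Lemma 2.4 (p. 10)] -/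
theorem quantitative_kn_conj4_of_csh (w : Sym2 (Fin n) → unitInterval) (hw : ∀ e, 0 < w e ∧ w e < 1)
    (hCSH : ∀ (o v x : Fin n) (Y : Finset (Fin n)) (D : List (Fin n)),
      o ≠ v → x ∉ Y → o ≠ x → v ≠ x → o ∉ Y → v ∉ Y → D.Nodup → (∀ d ∈ D, d ≠ x ∧ d ∉ Y ∧ d ≠ o ∧ d ≠ v) →
      CSHHolds w x (↑Y : Set (Fin n)) D o v)
    (A : Finset (Fin n)) (o c : Fin n) (F : Set (Fin n) → ℝ) (hF : ∀ S T : Set (Fin n), S ⊆ T → F S ≤ F T)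
    (hcA : c ∈ A) (hoA : o ∉ A)
    (hcmin : ∀ a ∈ A, ∫ ω, F (openCluster ω c) ∂(prodBernoulli w) ≤ ∫ ω, F (openCluster ω a) ∂(prodBernoulli w)) :
    ∑ a ∈ A.erase c, ((∫ ω, F (openCluster ω a) ∂(prodBernoulli w)) - ∫ ω, F (openCluster ω c) ∂(prodBernoulli w)) *
        avoidConst w a (↑(A.erase a) : Set (Fin n)) o ≤
      ∫ ω in ⋃ a' ∈ A, openConn o a', (F (openCluster ω o) - F (openCluster ω c)) ∂(prodBernoulli w) := by
  classical
  set μ := prodBernoulli w with hμ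
  have hmeas : ∀ S : Set (BondConfig (Fin n)), MeasurableSet S := fun _ => MeasurableSet.of_discrete
  have hint : ∀ (g : BondConfig (Fin n) → ℝ), Integrable g μ := fun g => Integrable.of_finite
  set δ : Fin n → ℝ := fun a => (∫ ω, F (openCluster ω a) ∂μ) - ∫ ω, F (openCluster ω c) ∂μ with hδ
  rcases (A.erase c).eq_empty_or_nonempty with h0 | hne
  · -- `A = {c}`: both sides vanish
    have hAc : A = {c} := by rw [← Finset.insert_erase hcA, h0]; rfl
    rw [h0, Finset.sum_empty, hAc]
    have hU : (⋃ a ∈ ({c} : Finset (Fin n)), (openConn o a : Set (BondConfig (Fin n)))) = openConn o c := by ext ω; simp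
    rw [hU, setIntegral_congr_fun (hmeas _) (g := fun _ => (0 : ℝ)) (fun ω hω => by
      show F (openCluster ω o) - F (openCluster ω c) = 0
      rw [openCluster_eq_of_reach (show (openGraph ω).Reachable o c from hω), sub_self])]
    simp
  obtain ⟨k, hk⟩ := hne
  have hkc : k ≠ c := (Finset.mem_erase.1 hk).1
  have hkA : k ∈ A := (Finset.mem_erase.1 hk).2
  set X' : Finset (Fin n) := A.erase k with hX'
  have hX'A : ∀ a ∈ X', a ∈ A := fun a ha => Finset.mem_of_mem_erase ha
  have hkX' : k ∉ X' := Finset.notMem_erase k A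
  have hcX' : c ∈ X' := Finset.mem_erase.2 ⟨hkc.symm, hcA⟩
  have hko : o ≠ k := fun h => hoA (h ▸ hkA)
  have hoX' : o ∉ X' := fun h => hoA (hX'A o h)
  have hmk : ∫ ω, F (openCluster ω c) ∂μ ≤ ∫ ω, F (openCluster ω k) ∂μ := hcmin k hkA
  set Dk : Set (BondConfig (Fin n)) := {ω : BondConfig (Fin n) | ∀ a ∈ (↑X' : Set (Fin n)), ¬ (openGraph ω).Reachable k a}
    with hDk
  set gk : BondConfig (Fin n) → ℝ := fun ω => F (openCluster ω k) - F (openCluster ω c) with hgk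
  set Gk : Set (Sym2 (Fin n)) → ℝ := fun K => F {z | z = k ∨ ∃ e ∈ K, z ∈ e} -
    ∫ η, F (openCluster (η \ BHK2006.barOf {k} K) c) ∂μ with hGk
  have hGk_mono : Monotone Gk := CovTau.monotone_projFun w c k F hF
  set Δo : ℝ := ∫ ω in ⋃ a' ∈ X', openConn o a', (F (openCluster ω o) - F (openCluster ω c)) ∂μ with hΔo
  set Δk : ℝ := ∫ ω in ⋃ a' ∈ X', openConn k a', (F (openCluster ω k) - F (openCluster ω c)) ∂μ with hΔk
  set Tko : ℝ := ∫ ω in Dk ∩ openConn k o, gk ω ∂μ with hTko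
  set J : ℝ := ∫ ω in Dk, gk ω ∂μ with hJ
  set M : ℝ := μ.real Dk with hM
  set E : ℝ := μ.real (Dk ∩ openConn k o) with hE
  set S' : ℝ := ∑ a ∈ X'.erase c, δ a * avoidConst w a (↑(A.erase a) : Set (Fin n)) o with hS'
  -- peel
  have hpeel : ∫ ω in ⋃ a' ∈ A, openConn o a', (F (openCluster ω o) - F (openCluster ω c)) ∂μ = Δo + Tko := by
    rw [hΔo, hTko, hgk]
    exact preSurplus_erase_add w A F c k o hkA
  -- tower identities
  have hDk_S : ∀ u : Fin n, Dk ∩ openConn k u =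
      {ω : BondConfig (Fin n) | ¬ (openGraph ω).Reachable k c} ∩
        {ω | openEdgeCluster ω k ∈ {K : Set (Sym2 (Fin n)) |
          (∀ a ∈ X', a ≠ c → ¬ (a = k ∨ ∃ e ∈ K, a ∈ e)) ∧ (u = k ∨ ∃ e ∈ K, u ∈ e)}} := by
    intro u; ext ω
    simp only [mem_inter_iff, hDk, mem_setOf_eq, Finset.mem_coe]
    constructor
    · rintro ⟨h1, h2⟩
      refine ⟨h1 c hcX', fun a ha _ => ?_, (reachable_iff_exists_mem_openEdgeCluster ω k u).1 h2⟩
      rw [← reachable_iff_exists_mem_openEdgeCluster]; exact h1 a ha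
    · rintro ⟨h1, h2, h3⟩
      refine ⟨fun a ha => ?_, (reachable_iff_exists_mem_openEdgeCluster ω k u).2 h3⟩
      by_cases hac : a = c
      · rw [hac]; exact h1
      · rw [reachable_iff_exists_mem_openEdgeCluster]; exact h2 a ha hac
  have hDk_0 : Dk = {ω : BondConfig (Fin n) | ¬ (openGraph ω).Reachable k c} ∩
        {ω | openEdgeCluster ω k ∈ {K : Set (Sym2 (Fin n)) | ∀ a ∈ X', a ≠ c → ¬ (a = k ∨ ∃ e ∈ K, a ∈ e)}} := by
    ext ω
    simp only [mem_inter_iff, hDk, mem_setOf_eq, Finset.mem_coe]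
    constructor
    · intro h1
      refine ⟨h1 c hcX', fun a ha _ => ?_⟩
      rw [← reachable_iff_exists_mem_openEdgeCluster]; exact h1 a ha
    · rintro ⟨h1, h2⟩ a ha
      by_cases hac : a = c
      · rw [hac]; exact h1
      · rw [reachable_iff_exists_mem_openEdgeCluster]; exact h2 a ha hac
  have towO : Tko = ∫ ω in Dk ∩ openConn k o, Gk (openEdgeCluster ω k) ∂μ := by
    simp only [hTko, hgk]; rw [hDk_S o]; exact CovTau.setIntegral_sub_eq_projFun w c k F _
  have tow0 : J = ∫ ω in Dk, Gk (openEdgeCluster ω k) ∂μ := by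
    simp only [hJ, hgk]; rw [hDk_0]; exact CovTau.setIntegral_sub_eq_projFun w c k F _
  have hJtot : J = δ k - Δk := by
    have h1 := integral_add_compl (hmeas Dk) (hint gk)
    have hDkc : Dkᶜ = ⋃ a' ∈ X', (openConn k a' : Set (BondConfig (Fin n))) := by
      ext ω
      rw [mem_iUnion_openConn, mem_compl_iff, hDk]
      simp only [mem_setOf_eq, Finset.mem_coe, not_forall, not_not, exists_prop]
    have h2 : ∫ ω in Dkᶜ, gk ω ∂μ = Δk := by
      rw [hDkc]
    have h3 : ∫ ω, gk ω ∂μ = δ k := by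
      rw [hgk, integral_sub (hint _) (hint _)]
    rw [hJ]; linarith
  -- one-cluster positive association for `C_k` given `k ↮ X'`:  `M·Tko ≥ J·E`
  have hG : Monotone ((connFamily k o).indicator (1 : Set (Sym2 (Fin n)) → ℝ)) :=
    monotone_indicator_one_of_isUpperSet (isUpperSet_connFamily k o)
  have hPA := BHK2006_clusterConditionalPositiveAssociation_holds (Fin n) w k (↑X' : Set (Fin n)) Gk
    ((connFamily k o).indicator 1) hGk_mono hG (by exact_mod_cast hkX')
  have hind : (fun ω : BondConfig (Fin n) => (connFamily k o).indicator (1 : Set (Sym2 (Fin n)) → ℝ) (openEdgeCluster ω k)) =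
      (openConn k o : Set (BondConfig (Fin n))).indicator 1 := by
    rw [indicator_comp_openEdgeCluster (connFamily k o) k, ← openConn_eq_setOf_connFamily]
  have hI1 : ∫ ω in Dk, (connFamily k o).indicator (1 : Set (Sym2 (Fin n)) → ℝ) (openEdgeCluster ω k) ∂μ = E := by
    rw [show (fun ω => (connFamily k o).indicator (1 : Set (Sym2 (Fin n)) → ℝ) (openEdgeCluster ω k)) =
      (openConn k o : Set (BondConfig (Fin n))).indicator 1 from hind, setIntegral_indicator_one_eq]
  have hI2 : ∫ ω in Dk, Gk (openEdgeCluster ω k) * (connFamily k o).indicator (1 : Set (Sym2 (Fin n)) → ℝ) (openEdgeCluster ω k) ∂μ =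
      ∫ ω in Dk ∩ openConn k o, Gk (openEdgeCluster ω k) ∂μ := by
    have e : ∀ ω : BondConfig (Fin n), Gk (openEdgeCluster ω k) *
        (connFamily k o).indicator (1 : Set (Sym2 (Fin n)) → ℝ) (openEdgeCluster ω k) =
        Gk (openEdgeCluster ω k) * (openConn k o : Set (BondConfig (Fin n))).indicator (1 : BondConfig (Fin n) → ℝ) ω :=
      fun ω => congrArg (fun t => Gk (openEdgeCluster ω k) * t) (congrFun hind ω)
    simp_rw [e]
    exact setIntegral_mul_indicator_one μ Dk (openConn k o) _
  have hC : J * E ≤ M * Tko := by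
    have h := hPA
    rw [hI1, hI2, ← tow0, ← towO] at h
    rw [hM]
    linarith [h]
  -- the QUANTITATIVE two-observer margin at `D = []`, observers `(o, k)`
  have hpm := preMargin_ge_sum_of_csh w hw o k
    (fun x Y D hxY hox hkx hoY hkY hD hDd => hCSH o k x Y D hko hxY hox hkx hoY hkY hD hDd)
    X' c [] F hF hcX' (fun a ha => hcmin a (hX'A a ha)) hoX' hkX' List.nodup_nil
    (fun d hd => by simp at hd)
  simp only [decoyList, cshMarg_nil] at hpm
  have hset0 : ((↑X' : Set (Fin n)) ∪ {d | d ∈ ([] : List (Fin n))}) = ↑X' := by simp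
  have hp0 : obsConst w o k ((↑X' : Set (Fin n)) ∪ {d | d ∈ ([] : List (Fin n))}) = E / M := by
    rw [hset0, obsConst, hE, hM, hDk, openConn_symm o k]
  rw [hp0] at hpm
  -- the coefficients of the margin are the `φ_a` of `A`
  have hcoef : ∀ a ∈ X'.erase c,
      avoidConst w a ((((↑X' : Set (Fin n)) ∪ {d | d ∈ ([] : List (Fin n))}) ∪ {k}) \ {a}) o =
        avoidConst w a (↑(A.erase a) : Set (Fin n)) o := by
    intro a ha
    have hak : a ≠ k := fun h => hkX' (h ▸ Finset.mem_of_mem_erase ha)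
    congr 1
    ext z
    simp only [hX', Finset.coe_erase, mem_sdiff, mem_union, mem_setOf_eq, List.not_mem_nil, mem_singleton_iff, Finset.mem_coe,
      or_false]
    constructor
    · rintro ⟨(⟨hz, _⟩ | rfl), hza⟩
      · exact ⟨hz, hza⟩
      · exact ⟨hkA, hza⟩
    · rintro ⟨hz, hza⟩
      by_cases hzk : z = k
      · exact ⟨Or.inr hzk, hza⟩
      · exact ⟨Or.inl ⟨hz, hzk⟩, hza⟩
  rw [Finset.sum_congr rfl (fun a ha => by rw [hcoef a ha])] at hpm
  -- hpm : S' ≤ Δo − (E/M)·Δk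
  have hMpos : 0 < M := by
    refine prodBernoulli_real_pos_of_nonempty hw ⟨∅, ?_⟩
    intro a ha h
    rw [HullPort.reachable_empty_iff] at h
    exact hkX' (h ▸ (Finset.mem_coe.1 ha))
  have hE0 : 0 ≤ E := measureReal_nonneg
  have hpm' : M * S' ≤ M * Δo - E * Δk := by
    have : M * S' ≤ M * (Δo - E / M * Δk) := mul_le_mul_of_nonneg_left hpm hMpos.le
    have e : M * (Δo - E / M * Δk) = M * Δo - E * Δk := by field_simp
    linarith [this, e]
  -- the detachment coefficient of the peeled relay: `φ_k = E / M`
  have hφk : avoidConst w k (↑(A.erase k) : Set (Fin n)) o = E / M := by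
    rw [avoidConst, hE, hM, hDk, hX']
  -- split the sum at `k` and assemble
  have hsum : ∑ a ∈ A.erase c, δ a * avoidConst w a (↑(A.erase a) : Set (Fin n)) o = δ k * (E / M) + S' := by
    rw [hS', hX', Finset.erase_right_comm, ← hφk]
    exact (Finset.add_sum_erase (A.erase c) (fun a => δ a * avoidConst w a (↑(A.erase a) : Set (Fin n)) o) hk).symm
  have hfin : M * (δ k * (E / M) + S') ≤ M * (Δo + Tko) := by
    have e1 : M * (δ k * (E / M) + S') = δ k * E + M * S' := by field_simp
    have hJE : J * E = δ k * E - Δk * E := by rw [hJtot]; ring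
    nlinarith [hC, hpm', hJE, e1]
  show ∑ a ∈ A.erase c, δ a * avoidConst w a (↑(A.erase a) : Set (Fin n)) o ≤ _
  rw [hsum, hpeel]
  exact le_of_mul_le_mul_left hfin hMpos

/-- **THE QUANTITATIVE KOZMA–NITZAN INEQUALITY, unconditionally** (finite graph `Fin n`, non-degenerate weights, `F` monotone on vertex sets,
`o ∉ A`, `c ∈ A` any relay of least mean):  `Σ_{a ∈ A∖c} (m_a − m_c)·μ(o ↔ a | a ↮ A∖a) ≤ E[(F(C(o)) − F(C(c))); o ↔ A]`
(= `quantitative_kn_conj4_of_csh` with prim-ineq-prove-1's `CSH.cshAll`, i.e. prim-hp-8's Theorem 1).  Sharpens Kozma–Nitzan's Conjecture 4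
(`kn_conj4_holds`) by the explicit nonnegative detachment sum. [cite: KozmaNitzan2024, Conj. 4 (p. 32), Lemma 2 (p. 6)] -/
theorem quantitative_kn_conj4_holds (w : Sym2 (Fin n) → unitInterval) (hw : ∀ e, 0 < w e ∧ w e < 1)
    (A : Finset (Fin n)) (o c : Fin n) (F : Set (Fin n) → ℝ) (hF : ∀ S T : Set (Fin n), S ⊆ T → F S ≤ F T)
    (hcA : c ∈ A) (hoA : o ∉ A)
    (hcmin : ∀ a ∈ A, ∫ ω, F (openCluster ω c) ∂(prodBernoulli w) ≤ ∫ ω, F (openCluster ω a) ∂(prodBernoulli w)) :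
    ∑ a ∈ A.erase c, ((∫ ω, F (openCluster ω a) ∂(prodBernoulli w)) - ∫ ω, F (openCluster ω c) ∂(prodBernoulli w)) *
        avoidConst w a (↑(A.erase a) : Set (Fin n)) o ≤
      ∫ ω in ⋃ a' ∈ A, openConn o a', (F (openCluster ω o) - F (openCluster ω c)) ∂(prodBernoulli w) :=
  quantitative_kn_conj4_of_csh w hw (CSH.cshAll n w hw) A o c F hF hcA hoA hcmin

/-- **Q-KN (prim-ineq-gen-6 FINDING-G4 §8), unconditionally**: on every finite graph with non-degenerate weights, for every relay set `A`, target `b`,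
observer `o ∉ A` and ANY most detached relay `c ∈ A` (`P(c ↔ b) ≤ P(a ↔ b)` for all `a ∈ A`),
`Σ_{a ∈ A∖c} φ_a · (P(a ↔ b) − P(c ↔ b)) ≤ P(o ↔ b, o ↔ A) − P(c ↔ b, o ↔ A)`,  `φ_a = P(o ↔ a | a ↮ A∖a)` —
the pre-FKG deficit of Kozma–Nitzan's Conjecture 2 dominates the attachment-weighted detachment gaps (`F = 1{b ∈ ·}` in `quantitative_kn_conj4_holds`).
[cite: KozmaNitzan2024, Conj. 2 / display (3) (p. 3), Thm. 3 (p. 10), Lemma 2 (p. 6)] -/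
theorem quantitativeKN_holds (w : Sym2 (Fin n) → unitInterval) (hw : ∀ e, 0 < w e ∧ w e < 1)
    (A : Finset (Fin n)) (o b c : Fin n) (hcA : c ∈ A) (hoA : o ∉ A)
    (hcmin : ∀ a ∈ A, (prodBernoulli w).real (openConn c b) ≤ (prodBernoulli w).real (openConn a b)) :
    ∑ a ∈ A.erase c, ((prodBernoulli w).real (openConn a b) - (prodBernoulli w).real (openConn c b)) *
        avoidConst w a (↑(A.erase a) : Set (Fin n)) o ≤
      (prodBernoulli w).real (openConn o b ∩ ⋃ a' ∈ A, openConn o a') -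
        (prodBernoulli w).real (openConn c b ∩ ⋃ a' ∈ A, openConn o a') := by
  classical
  have hmeas : ∀ S : Set (BondConfig (Fin n)), MeasurableSet S := fun _ => MeasurableSet.of_discrete
  have hint : ∀ (g : BondConfig (Fin n) → ℝ), Integrable g (prodBernoulli w) := fun g => Integrable.of_finite
  have hF : ∀ S T : Set (Fin n), S ⊆ T →
      (fun S : Set (Fin n) => if b ∈ S then (1 : ℝ) else 0) S ≤ (fun S : Set (Fin n) => if b ∈ S then (1 : ℝ) else 0) T := by
    intro S T hST
    by_cases hS : b ∈ S
    · simp [hS, hST hS]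
    · by_cases hT : b ∈ T
      · simp [hS, hT]
      · simp [hS, hT]
  have e : ∀ x : Fin n, (fun ω : BondConfig (Fin n) => if b ∈ openCluster ω x then (1 : ℝ) else 0) =
      (openConn x b : Set (BondConfig (Fin n))).indicator 1 := by
    intro x; funext ω
    by_cases hω : ω ∈ openConn x b
    · rw [Set.indicator_of_mem hω, Pi.one_apply]; exact if_pos (show b ∈ openCluster ω x from hω)
    · rw [Set.indicator_of_notMem hω]; exact if_neg (show b ∉ openCluster ω x from hω)
  have e1 : ∀ x : Fin n, ∫ ω, (if b ∈ openCluster ω x then (1 : ℝ) else 0) ∂(prodBernoulli w) =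
      (prodBernoulli w).real (openConn x b) := by
    intro x
    rw [e x, integral_indicator_one (hmeas _)]
  have e2 : ∀ x : Fin n, ∫ ω in ⋃ a' ∈ A, openConn o a', (if b ∈ openCluster ω x then (1 : ℝ) else 0) ∂(prodBernoulli w) =
      (prodBernoulli w).real (openConn x b ∩ ⋃ a' ∈ A, openConn o a') := by
    intro x
    rw [e x, integral_indicator_one (hmeas _), measureReal_restrict_apply (hmeas _)]
  have h := quantitative_kn_conj4_holds w hw A o c (fun S : Set (Fin n) => if b ∈ S then (1 : ℝ) else 0) hF hcA hoA
    (fun a ha => by rw [e1, e1]; exact hcmin a ha)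
  rw [integral_sub (hint _).integrableOn (hint _).integrableOn, e2, e2] at h
  simp only [e1] at h
  exact h

end PreFKGSurplus

namespace PreFKGSurplus

variable {n : ℕ}

/-- **Q-CIL_t (prim-ineq-gen-6 FINDING-G4 §10), unconditionally, for every level `t` and every `|A|`**: the threshold-sink instance
`F = 1{|· ∩ A| > t}` of the quantitative Kozma–Nitzan inequality.  With `X_u = |C(u) ∩ A|` (so `X_o = N`, the number of relays joined to `o`),
`c ∈ A` any relay minimising `P(X_c > t)`, `o ∉ A`, non-degenerate weights:
`Σ_{a ∈ A∖c} (P(X_a > t) − P(X_c > t)) · P(o ↔ a | a ↮ A∖a) ≤ P(N > t, o ↔ A) − P(X_c > t, o ↔ A)`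
(FINDING-G4 proved `t = 1` by Kozma–Nitzan's Lemma 2; the level `t = ⌊|A|/2⌋` is the cumulative-isolation route to `NoHeavyLowerTail`).
[cite: KozmaNitzan2024, Conj. 4 (p. 32), Lemma 2 (p. 6)] -/
theorem quantitativeCIL_holds (w : Sym2 (Fin n) → unitInterval) (hw : ∀ e, 0 < w e ∧ w e < 1)
    (A : Finset (Fin n)) (o c : Fin n) (t : ℕ) (hcA : c ∈ A) (hoA : o ∉ A)
    (hcmin : ∀ a ∈ A, (prodBernoulli w).real {ω : BondConfig (Fin n) | t < (A.filter fun a' => ω ∈ openConn c a').card} ≤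
      (prodBernoulli w).real {ω : BondConfig (Fin n) | t < (A.filter fun a' => ω ∈ openConn a a').card}) :
    ∑ a ∈ A.erase c, ((prodBernoulli w).real {ω : BondConfig (Fin n) | t < (A.filter fun a' => ω ∈ openConn a a').card} -
          (prodBernoulli w).real {ω : BondConfig (Fin n) | t < (A.filter fun a' => ω ∈ openConn c a').card}) *
        avoidConst w a (↑(A.erase a) : Set (Fin n)) o ≤
      (prodBernoulli w).real ({ω : BondConfig (Fin n) | t < (A.filter fun a' => ω ∈ openConn o a').card} ∩ ⋃ a' ∈ A, openConn o a') -
        (prodBernoulli w).real ({ω : BondConfig (Fin n) | t < (A.filter fun a' => ω ∈ openConn c a').card} ∩ ⋃ a' ∈ A, openConn o a') := by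
  classical
  have hmeas : ∀ S : Set (BondConfig (Fin n)), MeasurableSet S := fun _ => MeasurableSet.of_discrete
  have hint : ∀ (g : BondConfig (Fin n) → ℝ), Integrable g (prodBernoulli w) := fun g => Integrable.of_finite
  -- the threshold functional and its monotonicity
  have hF : ∀ S T : Set (Fin n), S ⊆ T →
      (fun S : Set (Fin n) => if t < (A.filter fun a' => a' ∈ S).card then (1 : ℝ) else 0) S ≤
        (fun S : Set (Fin n) => if t < (A.filter fun a' => a' ∈ S).card then (1 : ℝ) else 0) T := by
    intro S T hST
    have hcard : (A.filter fun a' => a' ∈ S).card ≤ (A.filter fun a' => a' ∈ T).card :=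
      Finset.card_le_card (Finset.monotone_filter_right A (fun a' _ h => hST h))
    by_cases hS : t < (A.filter fun a' => a' ∈ S).card
    · simp only [hS, if_true, lt_of_lt_of_le hS hcard]; exact le_rfl
    · simp only [hS, if_false]; split_ifs <;> norm_num
  -- reading the functional on configurations
  have e : ∀ x : Fin n, (fun ω : BondConfig (Fin n) =>
      (fun S : Set (Fin n) => if t < (A.filter fun a' => a' ∈ S).card then (1 : ℝ) else 0) (openCluster ω x)) =
      ({ω : BondConfig (Fin n) | t < (A.filter fun a' => ω ∈ openConn x a').card} : Set (BondConfig (Fin n))).indicator 1 := by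
    intro x; funext ω
    have hfil : (A.filter fun a' => a' ∈ openCluster ω x) = A.filter fun a' => ω ∈ openConn x a' :=
      Finset.filter_congr (fun a' _ => Iff.rfl)
    by_cases hω : ω ∈ ({ω : BondConfig (Fin n) | t < (A.filter fun a' => ω ∈ openConn x a').card} : Set (BondConfig (Fin n)))
    · rw [Set.indicator_of_mem hω, Pi.one_apply]
      simp only [hfil]
      exact if_pos hω
    · rw [Set.indicator_of_notMem hω]
      simp only [hfil]
      exact if_neg hω
  have e1 : ∀ x : Fin n, ∫ ω, (fun S : Set (Fin n) => if t < (A.filter fun a' => a' ∈ S).card then (1 : ℝ) else 0) (openCluster ω x)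
      ∂(prodBernoulli w) = (prodBernoulli w).real {ω : BondConfig (Fin n) | t < (A.filter fun a' => ω ∈ openConn x a').card} := by
    intro x
    rw [e x, integral_indicator_one (hmeas _)]
  have e2 : ∀ x : Fin n, ∫ ω in ⋃ a' ∈ A, openConn o a',
      (fun S : Set (Fin n) => if t < (A.filter fun a' => a' ∈ S).card then (1 : ℝ) else 0) (openCluster ω x) ∂(prodBernoulli w) =
      (prodBernoulli w).real ({ω : BondConfig (Fin n) | t < (A.filter fun a' => ω ∈ openConn x a').card} ∩ ⋃ a' ∈ A, openConn o a') := by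
    intro x
    rw [e x, integral_indicator_one (hmeas _), measureReal_restrict_apply (hmeas _)]
  have h := quantitative_kn_conj4_holds w hw A o c
    (fun S : Set (Fin n) => if t < (A.filter fun a' => a' ∈ S).card then (1 : ℝ) else 0) hF hcA hoA
    (fun a ha => by rw [e1, e1]; exact hcmin a ha)
  rw [integral_sub (hint _).integrableOn (hint _).integrableOn, e2, e2] at h
  simp only [e1] at h
  exact h

end PreFKGSurplus

end Summit.CriticalPhenomena.PercolationContinuityZ3.Theorems

end
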